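import Summits.NavierStokesRegularity.NavierStokesRegularity.Theorems.OddMorawetzOddMorawetzLocalPairingProps
import Summits.NavierStokesRegularity.NavierStokesRegularity.Theorems.OddMorawetzOddMorawetzLocalDensVInjective
import Summits.NavierStokesRegularity.NavierStokesRegularity.Theorems.OddMorawetzOddMorawetzLocalSmallLemmas
import Summits.NavierStokesRegularity.NavierStokesRegularity.Theorems.OddMorawetzOddMorawetzLocalCoeffSemantics
import Summits.NavierStokesRegularity.NavierStokesRegularity.Theorems.OddMorawetzOddMorawetzLocalStubJetDecay
import Summits.NavierStokesRegularity.NavierStokesRegularity.Theorems.OddMorawetzOddMorawetzLocalNormFSemantics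
import HarnessLib

/-!
# Crux `OddMorawetzLocal` (stmt-NavierStokesRegularity-1376) — assembly lemmas of the refutation

Glue used by the per-weight assemblies and the final refutation of `OddMorawetzLocal` (line `registered`, lead c1):
* `neg_integral_fderiv_eq_morawetzPairing` — for a smooth density `m` that agrees with `densV k τ` on the symmetric
  jets, the crux's functional `-∫ Dm(Jv)[J B(v,v)]` is the Morawetz pairing `morawetzPairing k v τ` (jets of smooth
  fields are symmetric; derivatives along a submodule only see the restriction);
* `morawetzPairing_sum_smul` — linearity of the pairing in the coefficient vector over a finite combination;
* `he_of_e1Check_cover` — the orbit-sum hypothesis `he` of `fixed_b3_span`/`tau_eq_sum_iso` from a covering family of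
  kernel checks `e1Check k reps lo n = true`;
* `exists_normF_eq_isoPolyF` — every isotropic basis polynomial is a fast normal form (so its monomials are pairwise
  distinct and sorted).
Everything is proved; no definitions; no named facts.
-/

noncomputable section

set_option linter.dupNamespace false

namespace Summit.NavierStokesRegularity.NavierStokesRegularity.Theorems.OddMorawetz

open MeasureTheory Literature.Analysis.FluidPDE

/-- **The crux functional is the Morawetz pairing.** If the smooth density `m` agrees with `densV k τ` on the
symmetric jets, then for a divergence-free Schwartz field `v`,
`-∫ Dm(Jv x)[J B(v,v) x] dx = morawetzPairing k v τ`. -/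
theorem neg_integral_fderiv_eq_morawetzPairing (k : ℕ) {m : Jet3 → ℝ} (hm : ContDiff ℝ (⊤ : ℕ∞) m) (τ : V k) (hmτ :
    ∀ z : Jet3, z ∈ symmJets → m z = densV k τ z) (v : EuclideanSpace ℝ (Fin 3) → EuclideanSpace ℝ (Fin 3)) (hv :
    Literature.Analysis.FluidPDE.IsSchwartzField v) (hd : Literature.Analysis.FluidPDE.VectorCalculus.IsDivFree v) :
    (-∫ x, fderiv ℝ m ((v x, iteratedFDeriv ℝ 1 v x, iteratedFDeriv ℝ 2 v x, iteratedFDeriv ℝ 3 v x) : Jet3)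
    ((Literature.Analysis.FluidPDE.eulerBilinear v v x, iteratedFDeriv ℝ 1
    (Literature.Analysis.FluidPDE.eulerBilinear v v) x, iteratedFDeriv ℝ 2
    (Literature.Analysis.FluidPDE.eulerBilinear v v) x, iteratedFDeriv ℝ 3
    (Literature.Analysis.FluidPDE.eulerBilinear v v) x) : Jet3)) = morawetzPairing k v τ := by
  rw [morawetzPairing_eq_fderiv_densV]
  congr 1
  refine integral_congr_ae (ae_of_all _ fun x => ?_)
  have hvs : ContDiff ℝ (⊤ : ℕ∞) v := ((isSchwartzField_iff v).1 hv).1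
  have hbs : ContDiff ℝ (⊤ : ℕ∞) (eulerBilinear v v) :=
    (Summit.NavierStokesRegularity.NavierStokesRegularity.Theorems.stub_jetDecay v hv hd).1
  exact fderiv_apply_eq_of_eqOn_submodule symmJets (hm.differentiable (by simp))
    ((contDiff_densV k τ).differentiable (by simp)) hmτ (jet_mem_symmJets v hvs x)
    (jet_mem_symmJets (eulerBilinear v v) hbs x)

/-- **Linearity of the pairing over a finite combination of coefficient vectors.** -/
theorem morawetzPairing_sum_smul (k : ℕ) (v : EuclideanSpace ℝ (Fin 3) → EuclideanSpace ℝ (Fin 3))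
    (hv : IsSchwartzField v) (hd : VectorCalculus.IsDivFree v) {ι : Type*} (s : Finset ι) (γ : ι → ℝ)
    (w : ι → V k) :
    morawetzPairing k v (∑ l ∈ s, γ l • w l) = ∑ l ∈ s, γ l * morawetzPairing k v (w l) := by
  obtain ⟨Λ, hΛ⟩ := exists_clm_morawetzPairing k v hv hd
  simp only [← hΛ, map_sum, map_smul, smul_eq_mul]

/-- **The orbit-sum hypothesis from a cover by kernel checks.** If every basis index lies in a range `[lo, lo+n)` with
`e1Check k reps lo n = true`, then every basis monomial has orbit sum `0` or a multiple of the normalised orbit sum of a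
listed representative (`e1Check_spec`). -/
theorem he_of_e1Check_cover (k : ℕ) (reps : List (List JVar))
    (hcov : ∀ i : ℕ, i < (idx k).length → ∃ lo n, lo ≤ i ∧ i < lo + n ∧ e1Check k reps lo n = true)
    (i : Fin (idx k).length) :
    orbitSum ((idx k).get i) = [] ∨
      ∃ (r : ℕ) (c : ℤ), r < reps.length ∧ reps.getD r [] = (minImage ((idx k).get i)).2 ∧
        orbitSum ((idx k).get i) = JPoly.smul c (orbitSumN (reps.getD r [])) := by
  obtain ⟨lo, n, hlo, hi, hchk⟩ := hcov i.val i.isLt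
  have h := e1Check_spec k reps lo n hchk (i.val - lo) (by omega)
  have hget : (idx k).getD (lo + (i.val - lo)) [] = (idx k).get i := by
    rw [show lo + (i.val - lo) = i.val by omega, List.getD_eq_getElem _ _ i.isLt]
    rfl
  rwa [hget] at h

/-- **Every isotropic basis polynomial is a fast normal form** (by cases on the descriptor). -/
theorem exists_normF_eq_isoPolyF (q : IsoDesc) : ∃ p : JPoly ℤ, isoPolyF q = JPoly.normF p := by
  cases q with
  | dens sh m => exact ⟨_, rfl⟩
  | null sh m => exact ⟨_, rfl⟩
  | ideal sh m => exact ⟨_, rfl⟩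
  | poly p => exact ⟨_, rfl⟩

/-- Monomials of an isotropic basis polynomial are pairwise distinct. -/
theorem isoPolyF_pairwise_ne (q : IsoDesc) : (isoPolyF q).Pairwise fun s t => s.2 ≠ t.2 := by
  obtain ⟨p, hp⟩ := exists_normF_eq_isoPolyF q
  rw [hp]
  exact JPoly.normF_pairwise_ne p

/-- From the kernel canonicity check of a polynomial to membership of its monomials in the basis `idx k`. -/
theorem mem_idx_of_canonical_check (k : ℕ) (q : JPoly ℤ)
    (h : (q.all fun t => decide (sortVars t.2 = t.2) && decide (t.2.length = 3) && decide (monoWeight t.2 = k) &&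
      t.2.all fun v => decide (sortIdx v.2 = v.2) && decide (v.2.length ≤ 3)) = true) :
    ∀ t ∈ q, t.2 ∈ idx k := by
  intro t ht
  rw [List.all_eq_true] at h
  have ht' := h t ht
  simp only [Bool.and_eq_true, decide_eq_true_eq, List.all_eq_true] at ht'
  obtain ⟨⟨⟨hsort, hlen⟩, hw⟩, hvars⟩ := ht'
  exact mem_idx_of_canonical hsort hlen (fun v hv => hvars v hv) hw

end Summit.NavierStokesRegularity.NavierStokesRegularity.Theorems.OddMorawetz

end
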